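import Summits.MatrixMultiplication.OmegaCensus.STPPSmallPatternKernelSearch122B
import Summits.MatrixMultiplication.OmegaCensus.STPPSmallPatternKernelProduct

/-!
# ω-census, `(1,2,2)^4` is infeasible in `ℤ/30` — kernel search, part 39

HONEST FRAMING (pub-omega census; verbatim): lottery ticket; floor = certified bounds/negative ranges.
Census STRUCTURE bookkeeping of the STPP track (seat pub-omega-stpp-3, gen 24; STRUCTURE row B5, the threshold column
`T2(H) = max {k : (1,2,2)^k ⊆ H}`, lower side), not progress on `ω`: small patterns in small groups bound no exponent.

Second-level chunks `STPP122Neg.search2xx (zcode 30) 4` (`decide +kernel`, ≈ 159 s predicted; a fixed start `(y, c'₀)`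
split by exclusion masks on the code of `b₁`); assembled in `STPPSmallPatternNone122K4Z30.lean`.

References: H. Cohn, R. Kleinberg, B. Szegedy, C. Umans, FOCS 2005 (arXiv:math/0511460), Def. 5.1.
-/

set_option Elab.async false  -- several kernel pieces: elaborate sequentially (memory)

namespace Summit.MatrixMultiplication.OmegaCensus

namespace STPP122Neg

open STPP211Neg

/-- Second-level-chunked kernel search, `ℤ/30`, `k = 4`, fixed start `(y, c'₀) = (2, 11)`, allowed `b₁` codes
[0, 1, 2, 3, 4, 11, 13, 19, 21] (≈ 64 s predicted). -/
theorem Z30k4p.x65 : search2xx (zcode 30) 4 [(2, 11, 1071110112)] = true := by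
  decide +kernel

/-- Second-level-chunked kernel search, `ℤ/30`, `k = 4`, fixed start `(y, c'₀) = (2, 11)`, allowed `b₁` codes
[5, 6, 7, 8, 9, 10] (≈ 70 s predicted). -/
theorem Z30k4p.x66 : search2xx (zcode 30) 4 [(2, 11, 1073739807)] = true := by
  decide +kernel

/-- Second-level-chunked kernel search, `ℤ/30`, `k = 4`, fixed start `(y, c'₀) = (2, 11)`, allowed `b₁` codes
[12, 14, 15, 16, 17, 18, 20, 22, 23, 24, 25, 26, 27, 28, 29] (≈ 25 s predicted). -/
theorem Z30k4p.x67 : search2xx (zcode 30) 4 [(2, 11, 2633727)] = true := by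
  decide +kernel

end STPP122Neg

end Summit.MatrixMultiplication.OmegaCensus
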